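import Summits.CriticalPhenomena.PercolationContinuityZ3.Theorems.PercNearOneGluingNoHeavyQuantTLCCertificate
import HarnessLib

/-!
# QUANT lane R8, the node G₁ for a GENERAL partner, part 4: the TILT ROWS — product top-low-capacity rows that hold for EVERY first factor of the
# given mean (regime form with tilt `1/(M₁−T₁)`, and the SHARP GATE-FREE form via the piecewise-linear majorant `ẽ` of the pull-back)

builds on p205010 (kernel theorem, internal audit signed; external expert review pending)

Support file (`--supports stmt-CriticalPhenomena-4575`), QUANT lane seat prim-quant-arm-2 (gen 40); memo `run/shared/lean/prim/quant/prim-quant-arm-2-g40/G1-GENERAL-G40.md`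
§2b/§3/§5.  Theorems only, standard axioms, no sorries.  Parts 1–3: `…QuantTLCShiftedTarget`, `…QuantTLCNaturalLayer`/`…NaturalRows`, `…QuantTLCCertificate` (this seat).
Merges the files announced as `…QuantTLCTiltRows` / `…QuantTLCTiltSharp` (declaration names unchanged).
PURE-TILT ROWS: the pull-back `e(a) = Σ_k μ₂(k)·c′(a+k)` of the product row `(j,i)` (target `T = T₁+T₂`) satisfies `e(a) ≤ λ(T₁ − a)` on `{0..M₁}` for one `λ`; then the row
holds for EVERY `μ₁ ≥ 0` of mass `1` and mean `T₁` (≈ 80 % of all product rows in the exact anatomy, memo §3).  (A) REGIME FORM **`lconv_tlcRow_of_tilt`** (`λ = 1/(M₁−T₁)`;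
hypotheses HL on the lows, HM on the mids above the mean, `i ≤ T₁ < M₁`); key lemma **`min_le_floor_div_usage`**: a compatible mid `h` of `i` is priced
`u/usage ≥ min(1, u(h+i−T)/(T−2i))` (equality in the linear regime of the minimal gate, `> 1` in the strict one).  (B) SHARP GATE-FREE FORM: every product-row
coefficient is `≤ u[n ≤ i] − [i < n]·clip(n)`, `clip(n) = max(0, min(1, u(n+i−T)/(T−2i)))` (**`tlcCoef_le_majorant`**), so `e ≤ ẽ(a) := Σ_k μ₂(k)(u[a+k ≤ i] − [i<a+k]·clip(a+k))`
(**`pullback_le_majorant`**) and `ẽ ≤ λ(T₁ − a)` on `{0..M₁}` ⟹ the row (**`lconv_tlcRow_of_tiltSharp`**; certifies 21 461 of the 21 996 tilt rows of memo §3(B), (A) 13 868,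
no non-tilt row).  HONEST STATUS: G₁ (`TLC2GateConvTLC`), SGC, `Quant.FarTreeRow` (light) OPEN; nothing here is a published result; RATE class log\* / honest sentence unchanged.
[this work]; parts 1–3: this seat; `usage`/`pairGate`, `usage_pos_of_compat`, `pairGate_lt_one`: prim-quant-stmt g22; relay top tilt rows: prim-quant-arm-2 g39.  The gluing rows
served [cite: KozmaNitzan2024, Conjecture 3 (p. 15)]; product measure [cite: Grimmett1999, §1.3 p. 10].
-/

noncomputable section

namespace Summit.CriticalPhenomena.PercolationContinuityZ3.Theorems

namespace Quant

open Finset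

namespace LawDec

/-! ### Every compatible mid is priced at least `min(1, u(h+i−T)/(T−2i))` -/
/-- **the unit price of a compatible mid, from below**: `0 < y < 1`, `2i < T < i + h`, `h ≤ j` ⟹
`min(1, u·(h + i − T)/(T − 2i)) ≤ u / usage y T j i h` (`u = y/(1−y)`): in the linear regime of the minimal gate (`ρ = (T−2i)/(h−i) ≥ y`)
`u/usage = u·(1/ρ − 1) = u(h+i−T)/(T−2i)`; in the strict regime (`ρ < y`) the gate is `< y`, so `usage < u` and `u/usage > 1`. [this work] -/
theorem min_le_floor_div_usage (y T : ℝ) (j i h : ℕ) (hy0 : 0 < y) (hy1 : y < 1) (hlow : 2 * (i : ℝ) < T)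
    (hcomp : T < (i : ℝ) + h) (hhj : h ≤ j) :
    min 1 (y / (1 - y) * (((h : ℝ) + i - T) / (T - 2 * (i : ℝ))))
      ≤ y / (1 - y) / usage y T j i h := by
  have h1y : 0 < 1 - y := by linarith
  have hu0 : 0 < y / (1 - y) := div_pos hy0 h1y
  have hih : i < h := by
    have : (i : ℝ) < h := by linarith
    exact_mod_cast this
  have hd : 0 < (h : ℝ) - i := by
    have : (i : ℝ) < h := by exact_mod_cast hih
    linarith
  have hs : 0 < T - 2 * (i : ℝ) := by linarith
  have hpos : 0 < usage y T j i h := usage_pos_of_compat y T j i h hy0 hy1 hlow hih (Or.inr hcomp)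
  have hnj : ¬ (j + 1 ≤ h) := by omega
  have hus : usage y T j i h = pairGate y T i h / (1 - pairGate y T i h) := by
    simp only [usage, gateOf, if_neg hnj]
  have hG1 : pairGate y T i h < 1 := pairGate_lt_one y T i h hy0 hy1 hlow hcomp
  set ρ : ℝ := (T - 2 * (i : ℝ)) / ((h : ℝ) - i) with hρ
  have hρ0 : 0 < ρ := div_pos hs hd
  rcases le_or_gt y ρ with hyρ | hρy
  · -- linear regime: pairGate = ρ
    have hG : pairGate y T i h = ρ := by
      unfold pairGate
      rw [← hρ]
      refine max_eq_left ?_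
      nlinarith
    have hval : y / (1 - y) / usage y T j i h = y / (1 - y) * (((h : ℝ) + i - T) / (T - 2 * (i : ℝ))) := by
      have hρ1 : ρ < 1 := by rw [← hG]; exact hG1
      have hq : (1 - ρ) / ρ = ((h : ℝ) + i - T) / (T - 2 * (i : ℝ)) := by
        rw [div_eq_div_iff hρ0.ne' hs.ne', hρ]
        field_simp
        ring
      rw [hus, hG, ← hq]
      have h1ρ : (1 - ρ) ≠ 0 := by intro h0; linarith
      field_simp
    rw [hval]
    exact min_le_right _ _
  · -- strict regime: the gate is below the floor, `u/usage > 1`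
    have hG : pairGate y T i h ≤ y := by
      unfold pairGate
      rw [← hρ]
      refine max_le hρy.le ?_
      nlinarith
    have hule : usage y T j i h ≤ y / (1 - y) := by
      rw [hus, div_le_div_iff₀ (by linarith) h1y]
      nlinarith
    have h1 : 1 ≤ y / (1 - y) / usage y T j i h := by
      rw [le_div_iff₀ hpos, one_mul]; exact hule
    exact le_trans (min_le_left _ _) h1

/-! ### The tilt rows -/
/-- **THE TILT ROWS, functional form.**  `0 < y < 1` (`u = y/(1−y)`); `μ₁ ≥ 0` on `{0..M₁}` with mass `1` and mean `T₁ < M₁` (nothing else);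
`μ₂ ≥ 0` with mass `1` on `{0..M₂}`; a product row `(j, i)`, `2i < T₁+T₂`, `i ≤ T₁`, in the regime (HL) + (HM) of the module docstring.
Then `Σ_h c′(h)·(lconv M₁ M₂ μ₁ μ₂)(h) ≤ 0`: pointwise `e(a) ≤ (T₁ − a)/(M₁ − T₁)` and `Σ_a μ₁(a)(T₁ − a) = 0`. [this work] -/
theorem lconv_tlcRow_functional_of_tilt (y T₁ T₂ : ℝ) (M₁ M₂ j i : ℕ) (μ₁ μ₂ : ℕ → ℝ)
    (hy0 : 0 < y) (hy1 : y < 1)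
    (h10 : ∀ a, 0 ≤ μ₁ a) (h11 : ∑ a ∈ Finset.range (M₁ + 1), μ₁ a = 1)
    (hT1 : ∑ a ∈ Finset.range (M₁ + 1), (a : ℝ) * μ₁ a = T₁) (hTM : T₁ < (M₁ : ℝ))
    (h20 : ∀ k, 0 ≤ μ₂ k) (h21 : ∑ k ∈ Finset.range (M₂ + 1), μ₂ k = 1)
    (hlow : 2 * (i : ℝ) < T₁ + T₂) (hiT : (i : ℝ) ≤ T₁)
    (HL : ∀ a : ℕ, a ≤ i → y / (1 - y) * (∑ k ∈ Finset.range (i - a + 1), μ₂ k) * ((M₁ : ℝ) - T₁) ≤ T₁ - a)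
    (HM : ∀ a : ℕ, T₁ < (a : ℝ) → a ≤ j → a ≤ M₁ →
      T₁ + T₂ - 2 * (i : ℝ) ≤ y / (1 - y) * ((a : ℝ) + i - (T₁ + T₂)) ∨
      ((a : ℝ) - T₁) * (T₁ + T₂ - 2 * (i : ℝ)) ≤ y / (1 - y) * ((a : ℝ) + i - (T₁ + T₂)) * ((M₁ : ℝ) - T₁)) :
    ∑ h ∈ Finset.range (M₁ + M₂ + 1), (y / (1 - y) * (if h ≤ i then (1 : ℝ) else 0) - (if j + 1 ≤ h then (1 : ℝ) else 0)
        - y / (1 - y) * (if h ≤ j ∧ T₁ + T₂ < (i : ℝ) + h then 1 / usage y (T₁ + T₂) j i h else 0))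
        * lconv M₁ M₂ μ₁ μ₂ h ≤ 0 := by
  have h1y : 0 < 1 - y := by linarith
  have hu0 : 0 < y / (1 - y) := div_pos hy0 h1y
  have hD : 0 < (M₁ : ℝ) - T₁ := by linarith
  set T : ℝ := T₁ + T₂ with hT
  set u : ℝ := y / (1 - y) with hu
  rw [sum_fun_mul_lconv_pullback]
  -- the pointwise bound `e(a) ≤ (T₁ − a)/(M₁ − T₁)`
  have hpt : ∀ a : ℕ, a ≤ M₁ →
      ∑ k ∈ Finset.range (M₂ + 1), μ₂ k *
          (u * (if a + k ≤ i then (1 : ℝ) else 0) - (if j + 1 ≤ a + k then (1 : ℝ) else 0)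
            - u * (if a + k ≤ j ∧ T < (i : ℝ) + ((a + k : ℕ) : ℝ) then 1 / usage y T j i (a + k) else 0))
        ≤ (T₁ - a) / ((M₁ : ℝ) - T₁) := by
    intro a haM
    -- nonnegativity of the capacity term
    have hcap0 : ∀ k : ℕ, 0 ≤ (if a + k ≤ j ∧ T < (i : ℝ) + ((a + k : ℕ) : ℝ) then 1 / usage y T j i (a + k) else 0) := by
      intro k
      split_ifs with hc
      · have hik : i < a + k := by
          have : (i : ℝ) < ((a + k : ℕ) : ℝ) := by linarith [hc.2]
          exact_mod_cast this
        exact div_nonneg zero_le_one (usage_pos_of_compat y T j i (a + k) hy0 hy1 hlow hik (Or.inr hc.2)).le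
      · exact le_rfl
    rcases le_or_gt (a : ℝ) T₁ with haT | haT
    · ------------------------------------------------------------ `a ≤ T₁`: only the low prices count
      have hterm : ∀ k : ℕ, μ₂ k *
          (u * (if a + k ≤ i then (1 : ℝ) else 0) - (if j + 1 ≤ a + k then (1 : ℝ) else 0)
            - u * (if a + k ≤ j ∧ T < (i : ℝ) + ((a + k : ℕ) : ℝ) then 1 / usage y T j i (a + k) else 0))
          ≤ u * (if k ≤ i - a ∧ a ≤ i then μ₂ k else 0) := by
        intro k
        have hg : 0 ≤ (if j + 1 ≤ a + k then (1 : ℝ) else 0) := by split_ifs <;> norm_num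
        have hc := hcap0 k
        by_cases hki : a + k ≤ i
        · rw [if_pos hki, if_pos (show k ≤ i - a ∧ a ≤ i from ⟨by omega, by omega⟩)]
          have := mul_nonneg (h20 k) (add_nonneg hg (mul_nonneg hu0.le hc))
          nlinarith [h20 k]
        · rw [if_neg hki, if_neg (show ¬ (k ≤ i - a ∧ a ≤ i) from fun h => hki (by omega))]
          have := mul_nonneg (h20 k) (add_nonneg hg (mul_nonneg hu0.le hc))
          nlinarith [h20 k]
      refine le_trans (Finset.sum_le_sum fun k _ => hterm k) ?_
      rw [← Finset.mul_sum]
      by_cases hai : a ≤ i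
      · -- the low `a`: (HL)
        have hS : ∑ k ∈ Finset.range (M₂ + 1), (if k ≤ i - a ∧ a ≤ i then μ₂ k else 0)
            ≤ ∑ k ∈ Finset.range (i - a + 1), μ₂ k := by
          have e1 : ∑ k ∈ Finset.range (M₂ + 1), (if k ≤ i - a ∧ a ≤ i then μ₂ k else 0)
              = ∑ k ∈ Finset.range (M₂ + 1), (if k ≤ i - a then μ₂ k else 0) :=
            Finset.sum_congr rfl fun k _ => by
              by_cases hk : k ≤ i - a
              · rw [if_pos ⟨hk, hai⟩, if_pos hk]
              · rw [if_neg (fun h => hk h.1), if_neg hk]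
          rw [e1, ← Finset.sum_filter]
          refine Finset.sum_le_sum_of_subset_of_nonneg ?_ (fun k _ _ => h20 k)
          intro k hk
          rw [Finset.mem_filter, Finset.mem_range] at hk
          rw [Finset.mem_range]; omega
        have hSn : 0 ≤ ∑ k ∈ Finset.range (i - a + 1), μ₂ k := Finset.sum_nonneg fun k _ => h20 k
        have hHL := HL a hai
        rw [le_div_iff₀ hD]
        calc (u * ∑ k ∈ Finset.range (M₂ + 1), (if k ≤ i - a ∧ a ≤ i then μ₂ k else 0)) * ((M₁ : ℝ) - T₁)
            ≤ (u * ∑ k ∈ Finset.range (i - a + 1), μ₂ k) * ((M₁ : ℝ) - T₁) :=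
              mul_le_mul_of_nonneg_right (mul_le_mul_of_nonneg_left hS hu0.le) hD.le
          _ ≤ T₁ - a := hHL
      · -- `i < a ≤ T₁`: nothing to pay
        have e0 : ∑ k ∈ Finset.range (M₂ + 1), (if k ≤ i - a ∧ a ≤ i then μ₂ k else 0) = 0 :=
          Finset.sum_eq_zero fun k _ => by rw [if_neg (fun h => hai h.2)]
        rw [e0, mul_zero]
        exact div_nonneg (by linarith) hD.le
    · ------------------------------------------------------------ `a > T₁`
      have hai : i < a := by
        have : (i : ℝ) < a := lt_of_le_of_lt hiT haT
        exact_mod_cast this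
      have haM' : (a : ℝ) ≤ M₁ := by exact_mod_cast haM
      by_cases hja : j + 1 ≤ a
      · ---------------------------------------------------------- a giant atom: every term is `−μ₂ k`
        have hterm : ∀ k : ℕ, μ₂ k *
            (u * (if a + k ≤ i then (1 : ℝ) else 0) - (if j + 1 ≤ a + k then (1 : ℝ) else 0)
              - u * (if a + k ≤ j ∧ T < (i : ℝ) + ((a + k : ℕ) : ℝ) then 1 / usage y T j i (a + k) else 0))
            = -μ₂ k := by
          intro k
          rw [if_neg (by omega : ¬ (a + k ≤ i)), if_pos (by omega : j + 1 ≤ a + k),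
            if_neg (fun h => absurd h.1 (by omega))]
          ring
        rw [Finset.sum_congr rfl fun k _ => hterm k, Finset.sum_neg_distrib, h21, le_div_iff₀ hD]
        linarith
      · ---------------------------------------------------------- a mid atom `T₁ < a ≤ j`: every term is at most `−m·μ₂ k`
        have haj : a ≤ j := by omega
        have hs : 0 < T - 2 * (i : ℝ) := by linarith
        set m : ℝ := min 1 (u * (((a : ℝ) + i - T) / (T - 2 * (i : ℝ)))) with hm
        have hterm : ∀ k : ℕ, μ₂ k *
            (u * (if a + k ≤ i then (1 : ℝ) else 0) - (if j + 1 ≤ a + k then (1 : ℝ) else 0)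
              - u * (if a + k ≤ j ∧ T < (i : ℝ) + ((a + k : ℕ) : ℝ) then 1 / usage y T j i (a + k) else 0))
            ≤ μ₂ k * (-m) := by
          intro k
          refine mul_le_mul_of_nonneg_left ?_ (h20 k)
          rw [if_neg (by omega : ¬ (a + k ≤ i)), mul_zero, zero_sub]
          have hak : ((a + k : ℕ) : ℝ) = (a : ℝ) + k := Nat.cast_add a k
          by_cases hgk : j + 1 ≤ a + k
          · rw [if_pos hgk, if_neg (fun h => absurd h.1 (by omega)), mul_zero, sub_zero]
            have : m ≤ 1 := min_le_left _ _
            linarith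
          · rw [if_neg hgk]
            have hakj : a + k ≤ j := by omega
            by_cases hc : T < (i : ℝ) + ((a + k : ℕ) : ℝ)
            · rw [if_pos ⟨hakj, hc⟩]
              have hkey := min_le_floor_div_usage y T j i (a + k) hy0 hy1 hlow hc hakj
              have hmono : m ≤ min 1 (u * ((((a + k : ℕ) : ℝ) + i - T) / (T - 2 * (i : ℝ)))) := by
                refine min_le_min le_rfl (mul_le_mul_of_nonneg_left ?_ hu0.le)
                rw [hak]
                exact div_le_div_of_nonneg_right (by linarith [(Nat.cast_nonneg k : (0 : ℝ) ≤ k)]) hs.le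
              have : m ≤ u / usage y T j i (a + k) := le_trans hmono hkey
              rw [← div_eq_mul_one_div]
              linarith
            · rw [if_neg (fun h => hc h.2), mul_zero, sub_zero]
              have hnum : (a : ℝ) + i - T ≤ 0 := by
                rw [hak] at hc
                linarith [(Nat.cast_nonneg k : (0 : ℝ) ≤ k), not_lt.1 hc]
              have h1 : m ≤ u * (((a : ℝ) + i - T) / (T - 2 * (i : ℝ))) := min_le_right _ _
              have hdn : ((a : ℝ) + i - T) / (T - 2 * (i : ℝ)) ≤ 0 := div_nonpos_iff.mpr (Or.inr ⟨hnum, hs.le⟩)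
              have h2 : u * (((a : ℝ) + i - T) / (T - 2 * (i : ℝ))) ≤ 0 := by
                rw [mul_comm]; exact mul_nonpos_of_nonpos_of_nonneg hdn hu0.le
              linarith
        refine le_trans (Finset.sum_le_sum fun k _ => hterm k) ?_
        rw [← Finset.sum_mul, h21, one_mul, le_div_iff₀ hD]
        -- `(a − T₁) ≤ m·(M₁ − T₁)` from (HM)
        have hle : ((a : ℝ) - T₁) ≤ m * ((M₁ : ℝ) - T₁) := by
          rcases HM a haT haj haM with h1 | h2
          · -- `u(a+i−T) ≥ T−2i`: `m = 1`
            have hge1 : 1 ≤ u * (((a : ℝ) + i - T) / (T - 2 * (i : ℝ))) := by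
              rw [mul_div_assoc', le_div_iff₀ hs, one_mul]; exact h1
            rw [hm, min_eq_left hge1, one_mul]
            linarith
          · rcases min_cases (1 : ℝ) (u * (((a : ℝ) + i - T) / (T - 2 * (i : ℝ)))) with ⟨hm1', _⟩ | ⟨hm2, _⟩
            · rw [hm, hm1', one_mul]
              linarith
            · rw [hm, hm2, mul_div_assoc', div_mul_eq_mul_div, le_div_iff₀ hs]
              linarith
        linarith
  -- sum against `μ₁`: the tilt is free
  calc ∑ a ∈ Finset.range (M₁ + 1), μ₁ a * ∑ k ∈ Finset.range (M₂ + 1), μ₂ k *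
          (u * (if a + k ≤ i then (1 : ℝ) else 0) - (if j + 1 ≤ a + k then (1 : ℝ) else 0)
            - u * (if a + k ≤ j ∧ T < (i : ℝ) + ((a + k : ℕ) : ℝ) then 1 / usage y T j i (a + k) else 0))
      ≤ ∑ a ∈ Finset.range (M₁ + 1), μ₁ a * ((T₁ - a) / ((M₁ : ℝ) - T₁)) :=
        Finset.sum_le_sum fun a ha => mul_le_mul_of_nonneg_left (hpt a (Nat.lt_succ_iff.1 (Finset.mem_range.1 ha))) (h10 a)
    _ = (1 / ((M₁ : ℝ) - T₁)) * ∑ a ∈ Finset.range (M₁ + 1), μ₁ a * (T₁ - a) := by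
        rw [Finset.mul_sum]
        exact Finset.sum_congr rfl fun a _ => by ring
    _ = 0 := by rw [sum_mul_tilt_eq_zero M₁ μ₁ T₁ h11 hT1, mul_zero]
    _ ≤ 0 := le_rfl
/-- **THE TILT ROWS, `LawDec.TLC` body.**  As `lconv_tlcRow_functional_of_tilt`, concluding the body of the `TLC` row `(j, i)` of
`lconv M₁ M₂ μ₁ μ₂` on `{0..M₁+M₂}` at target `T₁ + T₂` (`j ≤ M₁ + M₂`). [this work] -/
theorem lconv_tlcRow_of_tilt (y T₁ T₂ : ℝ) (M₁ M₂ j i : ℕ) (μ₁ μ₂ : ℕ → ℝ)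
    (hy0 : 0 < y) (hy1 : y < 1)
    (h10 : ∀ a, 0 ≤ μ₁ a) (h11 : ∑ a ∈ Finset.range (M₁ + 1), μ₁ a = 1)
    (hT1 : ∑ a ∈ Finset.range (M₁ + 1), (a : ℝ) * μ₁ a = T₁) (hTM : T₁ < (M₁ : ℝ))
    (h20 : ∀ k, 0 ≤ μ₂ k) (h21 : ∑ k ∈ Finset.range (M₂ + 1), μ₂ k = 1)
    (hij : i ≤ j) (hjM : j ≤ M₁ + M₂) (hlow : 2 * (i : ℝ) < T₁ + T₂) (hiT : (i : ℝ) ≤ T₁)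
    (HL : ∀ a : ℕ, a ≤ i → y / (1 - y) * (∑ k ∈ Finset.range (i - a + 1), μ₂ k) * ((M₁ : ℝ) - T₁) ≤ T₁ - a)
    (HM : ∀ a : ℕ, T₁ < (a : ℝ) → a ≤ j → a ≤ M₁ →
      T₁ + T₂ - 2 * (i : ℝ) ≤ y / (1 - y) * ((a : ℝ) + i - (T₁ + T₂)) ∨
      ((a : ℝ) - T₁) * (T₁ + T₂ - 2 * (i : ℝ)) ≤ y / (1 - y) * ((a : ℝ) + i - (T₁ + T₂)) * ((M₁ : ℝ) - T₁)) :
    y / (1 - y) * ∑ l ∈ Finset.range (i + 1), lconv M₁ M₂ μ₁ μ₂ l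
      ≤ ∑ h ∈ Finset.range (M₁ + M₂ + 1), (if j + 1 ≤ h then lconv M₁ M₂ μ₁ μ₂ h else 0)
        + y / (1 - y) * ∑ h ∈ Finset.range (M₁ + M₂ + 1),
            (if h ≤ j ∧ T₁ + T₂ < (i : ℝ) + h then lconv M₁ M₂ μ₁ μ₂ h / usage y (T₁ + T₂) j i h else 0) := by
  have hfun := lconv_tlcRow_functional_of_tilt y T₁ T₂ M₁ M₂ j i μ₁ μ₂ hy0 hy1 h10 h11 hT1 hTM h20 h21 hlow hiT HL HM
  rw [tlc_functional_sum y (T₁ + T₂) (M₁ + M₂) i j (lconv M₁ M₂ μ₁ μ₂) (by omega)] at hfun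
  linarith

/-! ## (B) The sharp gate-free form -/
/-- **THE GATE-FREE MAJORANT OF THE PULL-BACK, termwise**: for `0 < y < 1`, `i ≤ j`, `2i < T` and every atom `n`,
`c′(n) = u[n ≤ i] − [j+1 ≤ n] − u[n ≤ j ∧ T < i+n]/usage y T j i n ≤ u[n ≤ i] − [i < n]·max(0, min(1, u(n+i−T)/(T−2i)))`. [this work] -/
theorem tlcCoef_le_majorant (y T : ℝ) (j i n : ℕ) (hy0 : 0 < y) (hy1 : y < 1) (hij : i ≤ j) (hlow : 2 * (i : ℝ) < T) :
    y / (1 - y) * (if n ≤ i then (1 : ℝ) else 0) - (if j + 1 ≤ n then (1 : ℝ) else 0)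
        - y / (1 - y) * (if n ≤ j ∧ T < (i : ℝ) + n then 1 / usage y T j i n else 0)
      ≤ y / (1 - y) * (if n ≤ i then (1 : ℝ) else 0)
        - (if i < n then max 0 (min 1 (y / (1 - y) * (((n : ℝ) + i - T) / (T - 2 * (i : ℝ))))) else 0) := by
  have h1y : 0 < 1 - y := by linarith
  have hu0 : 0 < y / (1 - y) := div_pos hy0 h1y
  have hs : 0 < T - 2 * (i : ℝ) := by linarith
  by_cases hni : n ≤ i
  · -- a low: no giant, no compatible mid
    have g0 : (if j + 1 ≤ n then (1 : ℝ) else 0) = 0 := if_neg (by omega)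
    have l0 : (if i < n then max 0 (min 1 (y / (1 - y) * (((n : ℝ) + i - T) / (T - 2 * (i : ℝ))))) else 0) = 0 :=
      if_neg (by omega)
    have m0 : (if n ≤ j ∧ T < (i : ℝ) + n then 1 / usage y T j i n else 0) = 0 := by
      refine if_neg ?_
      rintro ⟨_, h2⟩
      have : (n : ℝ) ≤ i := by exact_mod_cast hni
      linarith
    rw [g0, l0, m0]
    linarith
  · have l1 : (if n ≤ i then (1 : ℝ) else 0) = 0 := if_neg hni
    set clip : ℝ := max 0 (min 1 (y / (1 - y) * (((n : ℝ) + i - T) / (T - 2 * (i : ℝ))))) with hclip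
    have l2 : (if i < n then max 0 (min 1 (y / (1 - y) * (((n : ℝ) + i - T) / (T - 2 * (i : ℝ))))) else 0) = clip :=
      if_pos (by omega)
    rw [l1, l2]
    have hclip1 : clip ≤ 1 := max_le zero_le_one (min_le_left _ _)
    by_cases hg : j + 1 ≤ n
    · have g1 : (if j + 1 ≤ n then (1 : ℝ) else 0) = 1 := if_pos hg
      have m0 : (if n ≤ j ∧ T < (i : ℝ) + n then 1 / usage y T j i n else 0) = 0 :=
        if_neg (fun h => absurd h.1 (by omega))
      rw [g1, m0]
      linarith
    · have g0 : (if j + 1 ≤ n then (1 : ℝ) else 0) = 0 := if_neg hg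
      rw [g0]
      have hnj : n ≤ j := by omega
      by_cases hc : T < (i : ℝ) + n
      · have m1 : (if n ≤ j ∧ T < (i : ℝ) + n then 1 / usage y T j i n else 0) = 1 / usage y T j i n := if_pos ⟨hnj, hc⟩
        rw [m1]
        have hkey := min_le_floor_div_usage y T j i n hy0 hy1 hlow hc hnj
        have hX : 0 < y / (1 - y) * (((n : ℝ) + i - T) / (T - 2 * (i : ℝ))) := mul_pos hu0 (div_pos (by linarith) hs)
        have hcl : clip = min 1 (y / (1 - y) * (((n : ℝ) + i - T) / (T - 2 * (i : ℝ)))) :=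
          max_eq_right (le_min zero_le_one hX.le)
        have e : y / (1 - y) * (1 / usage y T j i n) = y / (1 - y) / usage y T j i n := by
          rw [← div_eq_mul_one_div]
        rw [hcl, e]
        linarith
      · have m0 : (if n ≤ j ∧ T < (i : ℝ) + n then 1 / usage y T j i n else 0) = 0 := if_neg (fun h => hc h.2)
        rw [m0]
        have hX : y / (1 - y) * (((n : ℝ) + i - T) / (T - 2 * (i : ℝ))) ≤ 0 := by
          have hdn : ((n : ℝ) + i - T) / (T - 2 * (i : ℝ)) ≤ 0 :=
            div_nonpos_iff.mpr (Or.inr ⟨by linarith [not_lt.1 hc], hs.le⟩)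
          rw [mul_comm]; exact mul_nonpos_of_nonpos_of_nonneg hdn hu0.le
        have hcl : clip = 0 := by
          rw [hclip]; exact max_eq_left (le_trans (min_le_right _ _) hX)
        rw [hcl]
        linarith
/-- **the pull-back is dominated by the majorant `ẽ`** (`μ₂ ≥ 0`; `0 < y < 1`, `i ≤ j`, `2i < T₁+T₂`): for every atom `a`,
`Σ_k μ₂(k)·c′(a+k) ≤ ẽ(a) = Σ_k μ₂(k)·(u[a+k ≤ i] − [i < a+k]·clip(a+k))`. [this work] -/
theorem pullback_le_majorant (y T₁ T₂ : ℝ) (M₂ j i a : ℕ) (μ₂ : ℕ → ℝ) (hy0 : 0 < y) (hy1 : y < 1) (h20 : ∀ k, 0 ≤ μ₂ k)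
    (hij : i ≤ j) (hlow : 2 * (i : ℝ) < T₁ + T₂) :
    ∑ k ∈ Finset.range (M₂ + 1), μ₂ k *
        (y / (1 - y) * (if a + k ≤ i then (1 : ℝ) else 0) - (if j + 1 ≤ a + k then (1 : ℝ) else 0)
          - y / (1 - y) * (if a + k ≤ j ∧ T₁ + T₂ < (i : ℝ) + ((a + k : ℕ) : ℝ) then 1 / usage y (T₁ + T₂) j i (a + k) else 0))
      ≤ ∑ k ∈ Finset.range (M₂ + 1), μ₂ k *
        (y / (1 - y) * (if a + k ≤ i then (1 : ℝ) else 0)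
          - (if i < a + k then max 0 (min 1 (y / (1 - y) * ((((a + k : ℕ) : ℝ) + i - (T₁ + T₂)) / (T₁ + T₂ - 2 * (i : ℝ))))) else 0)) :=
  Finset.sum_le_sum fun k _ => mul_le_mul_of_nonneg_left (tlcCoef_le_majorant y (T₁ + T₂) j i (a + k) hy0 hy1 hij hlow) (h20 k)
/-- **THE TILT ROWS, SHARP FORM (functional).**  `0 < y < 1`; `μ₁ ≥ 0` on `{0..M₁}` with mass `1` and mean `T₁` (nothing else); `μ₂ ≥ 0`; a product row
`(j, i)`, `i ≤ j`, `2i < T₁+T₂`; a tilt `lam` with `ẽ(a) ≤ lam·(T₁ − a)` for every `a ≤ M₁`.  Then `Σ_h c′(h)·(lconv M₁ M₂ μ₁ μ₂)(h) ≤ 0`. [this work] -/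
theorem lconv_tlcRow_functional_of_tiltSharp (y T₁ T₂ : ℝ) (M₁ M₂ j i : ℕ) (μ₁ μ₂ : ℕ → ℝ) (lam : ℝ)
    (hy0 : 0 < y) (hy1 : y < 1)
    (h10 : ∀ a, 0 ≤ μ₁ a) (h11 : ∑ a ∈ Finset.range (M₁ + 1), μ₁ a = 1)
    (hT1 : ∑ a ∈ Finset.range (M₁ + 1), (a : ℝ) * μ₁ a = T₁)
    (h20 : ∀ k, 0 ≤ μ₂ k) (hij : i ≤ j) (hlow : 2 * (i : ℝ) < T₁ + T₂)
    (htilt : ∀ a : ℕ, a ≤ M₁ →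
      ∑ k ∈ Finset.range (M₂ + 1), μ₂ k *
          (y / (1 - y) * (if a + k ≤ i then (1 : ℝ) else 0)
            - (if i < a + k then max 0 (min 1 (y / (1 - y) * ((((a + k : ℕ) : ℝ) + i - (T₁ + T₂)) / (T₁ + T₂ - 2 * (i : ℝ))))) else 0))
        ≤ lam * (T₁ - a)) :
    ∑ h ∈ Finset.range (M₁ + M₂ + 1), (y / (1 - y) * (if h ≤ i then (1 : ℝ) else 0) - (if j + 1 ≤ h then (1 : ℝ) else 0)
        - y / (1 - y) * (if h ≤ j ∧ T₁ + T₂ < (i : ℝ) + h then 1 / usage y (T₁ + T₂) j i h else 0))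
        * lconv M₁ M₂ μ₁ μ₂ h ≤ 0 := by
  rw [sum_fun_mul_lconv_pullback]
  calc ∑ a ∈ Finset.range (M₁ + 1), μ₁ a * ∑ k ∈ Finset.range (M₂ + 1), μ₂ k *
          (y / (1 - y) * (if a + k ≤ i then (1 : ℝ) else 0) - (if j + 1 ≤ a + k then (1 : ℝ) else 0)
            - y / (1 - y) * (if a + k ≤ j ∧ T₁ + T₂ < (i : ℝ) + ((a + k : ℕ) : ℝ) then 1 / usage y (T₁ + T₂) j i (a + k) else 0))
      ≤ ∑ a ∈ Finset.range (M₁ + 1), μ₁ a * (lam * (T₁ - a)) :=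
        Finset.sum_le_sum fun a ha => mul_le_mul_of_nonneg_left
          (le_trans (pullback_le_majorant y T₁ T₂ M₂ j i a μ₂ hy0 hy1 h20 hij hlow)
            (htilt a (Nat.lt_succ_iff.1 (Finset.mem_range.1 ha)))) (h10 a)
    _ = lam * ∑ a ∈ Finset.range (M₁ + 1), μ₁ a * (T₁ - a) := by
        rw [Finset.mul_sum]
        exact Finset.sum_congr rfl fun a _ => by ring
    _ = 0 := by rw [sum_mul_tilt_eq_zero M₁ μ₁ T₁ h11 hT1, mul_zero]
    _ ≤ 0 := le_rfl
/-- **THE TILT ROWS, SHARP FORM (`LawDec.TLC` body)**: as `lconv_tlcRow_functional_of_tiltSharp`, concluding the body of the `TLC` row `(j, i)` of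
`lconv M₁ M₂ μ₁ μ₂` on `{0..M₁+M₂}` at target `T₁ + T₂` (`j ≤ M₁ + M₂`). [this work] -/
theorem lconv_tlcRow_of_tiltSharp (y T₁ T₂ : ℝ) (M₁ M₂ j i : ℕ) (μ₁ μ₂ : ℕ → ℝ) (lam : ℝ)
    (hy0 : 0 < y) (hy1 : y < 1)
    (h10 : ∀ a, 0 ≤ μ₁ a) (h11 : ∑ a ∈ Finset.range (M₁ + 1), μ₁ a = 1)
    (hT1 : ∑ a ∈ Finset.range (M₁ + 1), (a : ℝ) * μ₁ a = T₁)
    (h20 : ∀ k, 0 ≤ μ₂ k) (hij : i ≤ j) (hjM : j ≤ M₁ + M₂) (hlow : 2 * (i : ℝ) < T₁ + T₂)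
    (htilt : ∀ a : ℕ, a ≤ M₁ →
      ∑ k ∈ Finset.range (M₂ + 1), μ₂ k *
          (y / (1 - y) * (if a + k ≤ i then (1 : ℝ) else 0)
            - (if i < a + k then max 0 (min 1 (y / (1 - y) * ((((a + k : ℕ) : ℝ) + i - (T₁ + T₂)) / (T₁ + T₂ - 2 * (i : ℝ))))) else 0))
        ≤ lam * (T₁ - a)) :
    y / (1 - y) * ∑ l ∈ Finset.range (i + 1), lconv M₁ M₂ μ₁ μ₂ l
      ≤ ∑ h ∈ Finset.range (M₁ + M₂ + 1), (if j + 1 ≤ h then lconv M₁ M₂ μ₁ μ₂ h else 0)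
        + y / (1 - y) * ∑ h ∈ Finset.range (M₁ + M₂ + 1),
            (if h ≤ j ∧ T₁ + T₂ < (i : ℝ) + h then lconv M₁ M₂ μ₁ μ₂ h / usage y (T₁ + T₂) j i h else 0) := by
  have hfun := lconv_tlcRow_functional_of_tiltSharp y T₁ T₂ M₁ M₂ j i μ₁ μ₂ lam hy0 hy1 h10 h11 hT1 h20 hij hlow htilt
  rw [tlc_functional_sum y (T₁ + T₂) (M₁ + M₂) i j (lconv M₁ M₂ μ₁ μ₂) (by omega)] at hfun
  linarith

end LawDec

end Quant

end Summit.CriticalPhenomena.PercolationContinuityZ3.Theorems
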